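import Summits.ResolutionOfSingularities.ResolutionOfSingularities.Theorems.EquisingularLiftEquisingularLiftNatCarrierDeltaStalks
import Literature.AlgebraicGeometry.Motives.ZariskiChowCover
import Literature.AlgebraicGeometry.Resolution.AlterationsSectionDivisor
import HarnessLib

/-!
# [OURS · L1 W4.5(b)] T-CARRIER-Δ, scheme level (2/3): the Δ-centre `St_τ(K) ⊔ E` is FLAT over the
# discrete valuation ring (claim (i))

Support file of the crux chain w45b (cell `res-hironaka`, LADDER-RESOLUTION rung L, slot W4.5(b)), working crux
**EL♮ = `Theses.EquisingularLift.EquisingularLiftNat`** (stmt-ResolutionOfSingularities-20038), registered stub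
`stub_elnat_three_isolated_nonabs`; target **T-CARRIER-Δ** of res-L1-w45b-lead-2 (TARGETS 2026-08-27 (2)), claim (i):
«`V(C) → Spec O` flat» for the Δ-centre `C := St_τ(K) ⊔ E` of a cone `K` through a section `s` — clause (c)
`Flat (C.subschemeι ≫ τ ≫ q)` of a HorizChainE1 step, consumed by res-D-pv-013's T-Δ-ISO. OURS; NOT a statement of any
manuscript; AI-written, weaker than expert review. Filed `--supports stmt-ResolutionOfSingularities-20038 --as helper`.

PROOF (Hartshorne III 9.7: over a principal base flat = torsion-free; tree pattern
`ZariskiChow.flat_of_isIntegral_of_surjective`): flatness is affine-local on `V(C)`, and on an affine open the module of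
sections is torsion-free as soon as `ϖ` is a nonzerodivisor on every stalk met (sections are detected stalkwise); over the
generic point `ϖ` is a unit; over the closed point the stalk lies over `s(s₀)` (E1 locator, p509910) and is
`𝒪_{X₁,x'}/C_{x'}`, `C_{x'} = (Φ(c/c_j), c_j/1)` (`exists_stalk_strictTransformIdeal_sup_comap`), a localisation of
`R[I/c_j]/(Φ(c/c_j), c_j) ≅ (R/I)[T]/(Φ̄_j)` (p508912), where `ϖ` is a nonzerodivisor since `(R/𝔪_R)[T]` is a domain in
which `Φ̄_j ≠ 0` — D1 `deltaFlat` (p497957) for any `f` with `f̄ ≠ 0`.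

* ring level: `mem_map_of_mul_mem_localization` (regularity modulo an ideal passes to localisations),
  `mem_span_C_of_mul_mem_of_map_ne_zero` / `mem_span_of_C_mul_mem_of_map_ne_zero` (`f`, `C p` a regular pair in
  `Λ[T]` when `p` is a non-zero prime element of the domain `Λ` and `f mod p ≠ 0`),
  `mem_coneTransform_sup_of_algebraMap_mul_mem` (`ϖ_R` is a nonzerodivisor modulo `(Φ(c/c_j), c_j/1)` in `R[I/c_j]`);
* stalk level: `mem_stalkIdeal_carrierDelta_of_varpi_mul_mem` (`ϖ` is a nonzerodivisor on `𝒪_{X₁,x'}/C_{x'}` at the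
  points `x'` over `s(s₀)`);
* **`flat_carrierDelta_subschemeι_comp`** — claim (i) / clause (c).

HYPOTHESES (at `R = 𝒪_{P,s(s₀)}` only; `c`, `Φ` as in `…CarrierDeltaStalks`): `(c) + (ϖ_R) = 𝔪_R`, `ϖ_R ∉ (c)` (`ϖ_R` =
the germ of `q^*ϖ`, `Γgerm ∘ appTop` as in the route's `GoodAt`), `R/(c)` a domain, `Φ mod 𝔪_R ≠ 0`.
References: R. Hartshorne, *Algebraic Geometry* (1977), III Prop. 9.7; The Stacks Project, Tags 0539, 0804.
-/

set_option linter.dupNamespace false -- mandated namespace `Summit.<Summit>.<Problem>` of this single-conjunct summit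
set_option linter.overlappingInstances false -- signatures carry `[IsDomain O] [IsDiscreteValuationRing O]`

noncomputable section

open CategoryTheory AlgebraicGeometry TopologicalSpace IsLocalRing Opposite
open Literature.AlgebraicGeometry.Resolution
open Summit.ResolutionOfSingularities.ResolutionOfSingularities.Cruxes.EquisingularLift.StrataSplit

namespace Summit.ResolutionOfSingularities.ResolutionOfSingularities.Cruxes.EquisingularLiftNat.Sections

universe u

/-! ## Ring level -/

section RingLevel

/-- Regularity modulo an ideal passes to localisations: if `b·y ∈ 𝔞 ⇒ y ∈ 𝔞` in `B`, then the same holds for the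
image of `b` and the extension of `𝔞` in any localisation `S` of `B`. [folklore] -/
theorem mem_map_of_mul_mem_localization {B : Type*} [CommRing B] (M : Submonoid B) (S : Type*) [CommRing S]
    [Algebra B S] [IsLocalization M S] {b : B} {𝔞 : Ideal B} (h : ∀ y : B, b * y ∈ 𝔞 → y ∈ 𝔞) (y : S)
    (hy : algebraMap B S b * y ∈ 𝔞.map (algebraMap B S)) : y ∈ 𝔞.map (algebraMap B S) := by
  obtain ⟨⟨m, u⟩, hmu⟩ := IsLocalization.surj M y
  -- `y u = m`, so `(b m)/1 ∈ 𝔞 S`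
  have h1 : algebraMap B S (b * m) ∈ 𝔞.map (algebraMap B S) := by
    rw [map_mul, ← hmu, ← mul_assoc]
    exact Ideal.mul_mem_right _ _ hy
  obtain ⟨⟨⟨a, ha⟩, v⟩, hav⟩ := (IsLocalization.mem_map_algebraMap_iff M S).mp h1
  -- `(b m) v = a w`-ish: `∃ w ∈ M, w (b m v) = w a`
  obtain ⟨w, hw⟩ := (IsLocalization.eq_iff_exists M S).mp
    (show algebraMap B S (b * m * v) = algebraMap B S a by rw [map_mul]; exact hav)
  have hmem : b * ((w : B) * v * m) ∈ 𝔞 := by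
    have : (w : B) * (b * m * v) ∈ 𝔞 := by rw [hw]; exact Ideal.mul_mem_left _ _ ha
    convert this using 1; ring
  have hm : (w : B) * v * m ∈ 𝔞 := h _ hmem
  -- `y = m/u = (w v m)/(w v u)`
  have hunit : IsUnit (algebraMap B S ((w : B) * v * u)) := by
    rw [map_mul, map_mul]
    exact ((IsLocalization.map_units S w).mul (IsLocalization.map_units S v)).mul (IsLocalization.map_units S u)
  have hy' : y = algebraMap B S ((w : B) * v * m) * ↑hunit.unit⁻¹ := by
    have e1 : algebraMap B S ((w : B) * v * m) = y * algebraMap B S ((w : B) * v * u) := by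
      simp only [map_mul]; rw [← hmu]; ring
    rw [e1, mul_assoc, IsUnit.mul_val_inv, mul_one]
  rw [hy']
  exact Ideal.mul_mem_right _ _ (Ideal.mem_map_of_mem _ hm)

variable {Λ : Type u} [CommRing Λ] {σ : Type*}

/-- In `Λ[T]`, a polynomial `f` whose reduction modulo the prime element `p` is non-zero is a nonzerodivisor modulo
`C p`: `f·y ∈ (C p) ⇒ y ∈ (C p)` (`Λ[T]/(C p) = (Λ/p)[T]` is a domain). [folklore] -/
theorem mem_span_C_of_mul_mem_of_map_ne_zero {p : Λ} (hp : (Ideal.span {p}).IsPrime) {f : MvPolynomial σ Λ}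
    (hf : MvPolynomial.map (Ideal.Quotient.mk (Ideal.span {p})) f ≠ 0) (y : MvPolynomial σ Λ)
    (hy : f * y ∈ Ideal.span {(MvPolynomial.C p : MvPolynomial σ Λ)}) :
    y ∈ Ideal.span {(MvPolynomial.C p : MvPolynomial σ Λ)} := by
  -- adapted from `mem_span_delta_of_C_mul_mem` (…Theorems.EquisingularLiftEquisingularLiftNatDeltaCentre, p497957)
  haveI : IsDomain (Λ ⧸ Ideal.span {p}) := (Ideal.Quotient.isDomain_iff_prime _).mpr hp
  set red := MvPolynomial.map (σ := σ) (Ideal.Quotient.mk (Ideal.span {p})) with hred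
  have hker : RingHom.ker red = Ideal.span {(MvPolynomial.C p : MvPolynomial σ Λ)} := by
    rw [hred, MvPolynomial.ker_map, Ideal.mk_ker, Ideal.map_span, Set.image_singleton]
  have hy0 : red (f * y) = 0 := by rw [← RingHom.mem_ker, hker]; exact hy
  rw [map_mul] at hy0
  have : red y = 0 := (mul_eq_zero.mp hy0).resolve_left hf
  rwa [← RingHom.mem_ker, hker] at this
/-- … hence, if `Λ` is a domain and `p ≠ 0`, `C p` is a nonzerodivisor modulo `f`: `C p · y ∈ (f) ⇒ y ∈ (f)` (swap of the
regular sequence `C p, f`). This is the content of D1 `deltaFlat` for an arbitrary `f` with `f̄ ≠ 0`. [folklore] -/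
theorem mem_span_of_C_mul_mem_of_map_ne_zero [IsDomain Λ] {p : Λ} (hp0 : p ≠ 0) (hp : (Ideal.span {p}).IsPrime)
    {f : MvPolynomial σ Λ} (hf : MvPolynomial.map (Ideal.Quotient.mk (Ideal.span {p})) f ≠ 0)
    (y : MvPolynomial σ Λ) (hy : MvPolynomial.C p * y ∈ Ideal.span {f}) : y ∈ Ideal.span {f} :=
  mem_span_singleton_of_mul_mem_of_swap
    (mem_nonZeroDivisors_of_ne_zero (by rwa [Ne, MvPolynomial.C_eq_zero]))
    (mem_span_C_of_mul_mem_of_map_ne_zero hp hf) hy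

/-- Reduction of `map` along two surjections with the same kernel: if `map g F = 0` then every coefficient of `F` lies
in `ker g`. [folklore] -/
theorem coeff_mem_ker_of_map_eq_zero {S : Type*} [CommRing S] (g : Λ →+* S) {F : MvPolynomial σ Λ}
    (h : MvPolynomial.map g F = 0) (m : σ →₀ ℕ) : F.coeff m ∈ RingHom.ker g := by
  have := congrArg (MvPolynomial.coeff m) h
  rwa [MvPolynomial.coeff_map, MvPolynomial.coeff_zero] at this

/-- If every coefficient of `F` lies in `ker g` then `map g F = 0`. [folklore] -/
theorem map_eq_zero_of_coeff_mem_ker {S : Type*} [CommRing S] (g : Λ →+* S) {F : MvPolynomial σ Λ}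
    (h : ∀ m, F.coeff m ∈ RingHom.ker g) : MvPolynomial.map g F = 0 := by
  ext m
  rw [MvPolynomial.coeff_map, MvPolynomial.coeff_zero]
  exact h m
variable {R : Type u} [CommRing R] {r : ℕ} (c : Fin r → R) (j : Fin r)

/-- **`ϖ_R` is a nonzerodivisor modulo `(Φ(c/c_j), c_j/1)` in the chart algebra `R[I/c_j]`.** Hypotheses: `c`
quasi-regular, `R/(c)` a domain, `ϖ_R ∉ (c)`, `𝔫 := (c) + (ϖ_R)` prime, and the dehomogenisation `Φ_j` non-zero modulo
`𝔫`. Via `R[I/c_j]/(Φ(c/c_j), c_j) ≅ (R/(c))[T]/(Φ̄_j)` (`exists_quotient_coneTransform_sup_equiv`, p508912) this is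
`mem_span_of_C_mul_mem_of_map_ne_zero` for `Λ = R/(c)`, `p = ϖ̄_R`. [folklore] -/
theorem mem_coneTransform_sup_of_algebraMap_mul_mem (hx : IsQuasiRegular c)
    [IsDomain (R ⧸ Ideal.span (Set.range c))] (Φ : MvPolynomial (Fin r) R) (ϖR : R)
    (hϖc : ϖR ∉ Ideal.span (Set.range c)) (h𝔫 : (Ideal.span (Set.range c) ⊔ Ideal.span {ϖR}).IsPrime)
    (hΦ𝔫 : MvPolynomial.map (Ideal.Quotient.mk (Ideal.span (Set.range c) ⊔ Ideal.span {ϖR})) (dehomogenize j Φ) ≠ 0)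
    (y : blowupAlgebra (Ideal.span (Set.range c)) (c j))
    (hy : algebraMap R (blowupAlgebra (Ideal.span (Set.range c)) (c j)) ϖR * y ∈
      Ideal.span {MvPolynomial.aeval (blowupAlgebra.frac c j) Φ} ⊔
        Ideal.span {algebraMap R (blowupAlgebra (Ideal.span (Set.range c)) (c j)) (c j)}) :
    y ∈ Ideal.span {MvPolynomial.aeval (blowupAlgebra.frac c j) Φ} ⊔
      Ideal.span {algebraMap R (blowupAlgebra (Ideal.span (Set.range c)) (c j)) (c j)} := by
  obtain ⟨ε, hεa, -⟩ := exists_quotient_coneTransform_sup_equiv c j hx Φ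
  -- `p := ϖ_R mod (c)` is a non-zero prime element of the domain `R/(c)`, and `Φ̄_j mod p ≠ 0`
  have hp0 : Ideal.Quotient.mk (Ideal.span (Set.range c)) ϖR ≠ 0 := fun h =>
    hϖc (Ideal.Quotient.eq_zero_iff_mem.mp h)
  have hspan : Ideal.span {Ideal.Quotient.mk (Ideal.span (Set.range c)) ϖR} =
      (Ideal.span (Set.range c) ⊔ Ideal.span {ϖR}).map (Ideal.Quotient.mk (Ideal.span (Set.range c))) := by
    rw [Ideal.map_sup, Ideal.map_quotient_self, bot_sup_eq, Ideal.map_span, Set.image_singleton]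
  have hp : (Ideal.span {Ideal.Quotient.mk (Ideal.span (Set.range c)) ϖR}).IsPrime := by
    rw [hspan]
    exact Ideal.map_isPrime_of_surjective Ideal.Quotient.mk_surjective (by rw [Ideal.mk_ker]; exact le_sup_left)
  have hcomap : (Ideal.span {Ideal.Quotient.mk (Ideal.span (Set.range c)) ϖR}).comap
      (Ideal.Quotient.mk (Ideal.span (Set.range c))) = Ideal.span (Set.range c) ⊔ Ideal.span {ϖR} := by
    rw [hspan, Ideal.comap_map_of_surjective _ Ideal.Quotient.mk_surjective, ← RingHom.ker_eq_comap_bot,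
      Ideal.mk_ker, sup_comm (Ideal.span (Set.range c)), sup_assoc, sup_idem]
  have hfp : MvPolynomial.map (Ideal.Quotient.mk (Ideal.span {Ideal.Quotient.mk (Ideal.span (Set.range c)) ϖR}))
      (MvPolynomial.map (Ideal.Quotient.mk (Ideal.span (Set.range c))) (dehomogenize j Φ)) ≠ 0 := by
    intro h0
    apply hΦ𝔫
    rw [MvPolynomial.map_map] at h0
    apply map_eq_zero_of_coeff_mem_ker
    intro m
    have hm := coeff_mem_ker_of_map_eq_zero _ h0 m
    rw [RingHom.mem_ker, RingHom.comp_apply, Ideal.Quotient.eq_zero_iff_mem, ← Ideal.mem_comap, hcomap] at hm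
    rwa [RingHom.mem_ker, Ideal.Quotient.eq_zero_iff_mem]
  -- transport through `ε`
  have h1 : ε (Ideal.Quotient.mk _ (algebraMap R _ ϖR)) * ε (Ideal.Quotient.mk _ y) = 0 := by
    rw [← map_mul, ← map_mul, Ideal.Quotient.eq_zero_iff_mem.mpr hy, map_zero]
  obtain ⟨a, ha⟩ := Ideal.Quotient.mk_surjective (ε (Ideal.Quotient.mk _ y))
  rw [hεa, ← ha, ← map_mul, Ideal.Quotient.eq_zero_iff_mem] at h1
  have ha0 := mem_span_of_C_mul_mem_of_map_ne_zero hp0 hp hfp a h1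
  have : ε (Ideal.Quotient.mk _ y) = 0 := by rw [← ha]; exact Ideal.Quotient.eq_zero_iff_mem.mpr ha0
  rw [← Ideal.Quotient.eq_zero_iff_mem]
  exact ε.injective (this.trans (map_zero ε).symm)

end RingLevel

/-! ## Stalk level: `ϖ` is a nonzerodivisor on `𝒪_{X₁,x'}/C_{x'}` at the points over `s(s₀)` -/

section Stalk

variable {X X' : Scheme.{u}} {τ : X' ⟶ X} {J : X.IdealSheafData}

/-- From `Φ mod 𝔪_R ≠ 0` to `Φ mod (c) ≠ 0` (`(c) ⊆ 𝔪_R`). [folklore] -/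
theorem map_mk_ne_zero_of_map_residue_ne_zero {R : Type u} [CommRing R] [IsLocalRing R] {σ : Type*}
    {I : Ideal R} (hI : I ≤ maximalIdeal R) {Φ : MvPolynomial σ R}
    (hΦ : MvPolynomial.map (IsLocalRing.residue R) Φ ≠ 0) : MvPolynomial.map (Ideal.Quotient.mk I) Φ ≠ 0 := by
  intro h0
  apply hΦ
  apply map_eq_zero_of_coeff_mem_ker
  intro m
  have hm := coeff_mem_ker_of_map_eq_zero _ h0 m
  rw [Ideal.mk_ker] at hm
  rw [IsLocalRing.ker_residue]
  exact hI hm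

set_option maxHeartbeats 400000 in -- the chart algebra `blowupAlgebra` is a subalgebra of a localisation: slow instance unification (cf. p506193)
/-- **`ϖ` is a nonzerodivisor on the local rings of the Δ-centre over its special point.** Let `τ : X' → X` be a
blow-up along `J`, `X'` locally Noetherian, `x' ∈ X'` with `τ x' = p ∈ supp J`; at `R = 𝒪_{X,p}` assume the cone
hypothesis (`J_p = (c)`, `c` quasi-regular, `R/(c)` a domain, `K_p = (Φ(c))`, `Φ` a form of degree `d`) together with an
element `ϖ_R ∈ R`, the germ at `p` of a global section `v` (in use: `v = q^* ϖ`), such that `(c) + (ϖ_R) = 𝔪_R`,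
`ϖ_R ∉ (c)`, and `Φ mod 𝔪_R ≠ 0`. Then for `C = St_τ(K) ⊔ J·𝒪_{X'}`: `τ^♯(ϖ_R) · a ∈ C_{x'} ⇒ a ∈ C_{x'}` in
`𝒪_{X',x'}`. (Stated with a variable point `p` and `τ x' = p` so that data given at a named point — `p = s(s₀)` —
apply without transport.) [folklore] -/
theorem mem_stalkIdeal_carrierDelta_of_varpi_mul_mem [IsLocallyNoetherian X'] (hτ : IsBlowup τ J)
    (K : X.IdealSheafData) (x' : X') (p : X) (hp : τ x' = p) (hpJ : p ∈ (J.support : Set X)) {r : ℕ}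
    (c : Fin r → X.presheaf.stalk p) (hcJ : Ideal.span (Set.range c) = stalkIdeal J p)
    (hc : IsQuasiRegular c) [IsDomain (X.presheaf.stalk p ⧸ Ideal.span (Set.range c))]
    {d : ℕ} (Φ : MvPolynomial (Fin r) (X.presheaf.stalk p)) (hΦd : Φ.IsHomogeneous d)
    (hK : stalkIdeal K p = Ideal.span {MvPolynomial.eval c Φ}) (v : Γ(X, ⊤))
    (h𝔪 : Ideal.span (Set.range c) ⊔ Ideal.span {(X.presheaf.Γgerm p).hom v} = maximalIdeal (X.presheaf.stalk p))
    (hϖc : (X.presheaf.Γgerm p).hom v ∉ Ideal.span (Set.range c))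
    (hΦ𝔪 : MvPolynomial.map (IsLocalRing.residue (X.presheaf.stalk p)) Φ ≠ 0)
    (a : X'.presheaf.stalk x')
    (ha : (τ.stalkMap x').hom ((X.presheaf.Γgerm (τ x')).hom v) * a ∈
      stalkIdeal (strictTransformIdeal τ J K ⊔ J.comap τ) x') :
    a ∈ stalkIdeal (strictTransformIdeal τ J K ⊔ J.comap τ) x' := by
  subst hp
  -- name the germ `ϖ_R` of `v` at `τ x'`
  obtain ⟨ϖR, hϖR⟩ : ∃ ϖR : X.presheaf.stalk (τ x'), (X.presheaf.Γgerm (τ x')).hom v = ϖR := ⟨_, rfl⟩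
  rw [hϖR] at h𝔪 hϖc ha
  have hI𝔪 : Ideal.span (Set.range c) ≤ maximalIdeal (X.presheaf.stalk (τ x')) := h𝔪 ▸ le_sup_left
  have hΦ : MvPolynomial.map (Ideal.Quotient.mk (Ideal.span (Set.range c))) Φ ≠ 0 :=
    map_mk_ne_zero_of_map_residue_ne_zero hI𝔪 hΦ𝔪
  obtain ⟨j, 𝔔, χ, e, hχ, he, -, -, -, hC, -⟩ :=
    exists_stalk_strictTransformIdeal_sup_comap hτ K x' hpJ c hcJ hc Φ hΦd hΦ hK
  letI := χ.toAlgebra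
  haveI : IsLocalization.AtPrime (X'.presheaf.stalk x') 𝔔.asIdeal := isLocalization_stalk_of_ringEquiv 𝔔 x' χ e he
  -- the dehomogenisation is non-zero modulo `𝔪_R = (c) + (ϖ_R)`
  have hΦ𝔫 : MvPolynomial.map (Ideal.Quotient.mk (Ideal.span (Set.range c) ⊔ Ideal.span {ϖR}))
      (dehomogenize j Φ) ≠ 0 := by
    rw [map_dehomogenize]
    refine dehomogenize_ne_zero_of_isHomogeneous j (hΦd.map _) ?_
    intro h0
    apply hΦ𝔪
    apply map_eq_zero_of_coeff_mem_ker
    intro m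
    have hm := coeff_mem_ker_of_map_eq_zero _ h0 m
    rw [Ideal.mk_ker, h𝔪] at hm
    rwa [IsLocalRing.ker_residue]
  have h𝔫 : (Ideal.span (Set.range c) ⊔ Ideal.span {ϖR}).IsPrime := by
    rw [h𝔪]; exact (maximalIdeal.isMaximal _).isPrime
  -- `C_{x'} = 𝔞 · 𝒪_{X',x'}` for `𝔞 = (Φ(c/c_j), c_j/1) ⊆ B`, and `τ^♯ ϖ_R = χ(ϖ_R/1)`
  have hCmap : stalkIdeal (strictTransformIdeal τ J K ⊔ J.comap τ) x' =
      (Ideal.span {MvPolynomial.aeval (blowupAlgebra.frac c j) Φ} ⊔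
        Ideal.span {algebraMap _ (blowupAlgebra (Ideal.span (Set.range c)) (c j)) (c j)}).map
        (algebraMap (blowupAlgebra (Ideal.span (Set.range c)) (c j)) (X'.presheaf.stalk x')) := by
    rw [hC, Ideal.map_sup, Ideal.map_span, Ideal.map_span, Set.image_singleton, Set.image_singleton]
    rfl
  have hϖ : (τ.stalkMap x').hom ϖR =
      algebraMap (blowupAlgebra (Ideal.span (Set.range c)) (c j)) (X'.presheaf.stalk x')
        (algebraMap _ (blowupAlgebra (Ideal.span (Set.range c)) (c j)) ϖR) := (hχ ϖR).symm
  rw [hCmap] at ha ⊢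
  rw [hϖ] at ha
  exact mem_map_of_mul_mem_localization 𝔔.asIdeal.primeCompl (X'.presheaf.stalk x')
    (mem_coneTransform_sup_of_algebraMap_mul_mem c j hc Φ ϖR hϖc h𝔫 hΦ𝔫) a ha

end Stalk



/-! ## Claim (i): the Δ-centre is flat over `Spec O` -/

section Flat

variable (O : Type) [CommRing O] [IsDomain O] [IsDiscreteValuationRing O]

/-- Over a point of `Spec O` (`O` a DVR) other than the closed point — i.e. the generic point `(0)` — the germ of a
non-zero `ϖ ∈ O` is a unit of the stalk. [folklore] -/
theorem isUnit_germ_of_ne_closedPoint (y : Spec (.of O)) (hy : y ≠ IsLocalRing.closedPoint O) {ϖ : O}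
    (hϖ : ϖ ≠ 0) :
    IsUnit (((Spec (.of O)).presheaf.germ ⊤ y trivial).hom ((Scheme.ΓSpecIso (.of O)).inv.hom ϖ)) := by
  letI := StructureSheaf.stalkAlgebra O y
  haveI := StructureSheaf.IsLocalization.to_stalk O y
  have hy0 : y.asIdeal = ⊥ := by
    by_contra h
    exact hy (PrimeSpectrum.ext (IsLocalRing.eq_maximalIdeal (IsPrime.to_maximal_ideal (hpi := y.2) h)))
  have hmem : ϖ ∈ y.asIdeal.primeCompl := by
    change ϖ ∉ y.asIdeal
    rw [hy0]
    exact hϖ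
  exact IsLocalization.map_units ((Spec.structureSheaf O).presheaf.stalk y) (⟨ϖ, hmem⟩ : y.asIdeal.primeCompl)

/-- The germ of `f.appLE ⊤ V s` at `z ∈ V` is the stalk map applied to the germ of `s`. [folklore] -/
theorem germ_appLE_top {X Y : Scheme.{u}} (g : X ⟶ Y) (V : X.Opens) (z : X) (hz : z ∈ V) (t : Γ(Y, ⊤)) :
    (X.presheaf.germ V z hz).hom ((g.appLE ⊤ V le_top).hom t) =
      (g.stalkMap z).hom ((Y.presheaf.germ ⊤ (g z) trivial).hom t) := by
  rw [Scheme.Hom.germ_stalkMap_apply, Scheme.Hom.appLE]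
  simp only [CommRingCat.hom_comp, RingHom.comp_apply]
  rw [← CommRingCat.comp_apply, X.presheaf.germ_res]

/-- **CLAIM (i) of T-CARRIER-Δ / clause (c) of a HorizChainE1 step: the Δ-centre is FLAT over `Spec O`.** Let `O` be a
DVR with uniformizer `ϖ`, `q : P → Spec O` separated, `s` a section, `τ : X₁ → P` a blow-up along `ker s` with `X₁`
locally Noetherian, `K` an ideal sheaf on `P`, and at `R = 𝒪_{P, s(s₀)}`: `(ker s)_{s(s₀)} = (c₁, …, c_r)` with `c`
quasi-regular and `R/(c)` a domain, `K_{s(s₀)} = (Φ(c))` for a form `Φ` of degree `d`, `(c) + (ϖ_R) = 𝔪_R` and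
`ϖ_R ∉ (c)` for the germ `ϖ_R` of `q^*ϖ`, and `Φ mod 𝔪_R ≠ 0`. Then
`V(St_τ(K) ⊔ (ker s)·𝒪_{X₁}) → X₁ → P → Spec O` is flat (torsion-free = flat over the principal ring `O`; `ϖ` is a unit
at the stalks over the generic point and a nonzerodivisor at the stalks over the closed point by
`mem_stalkIdeal_carrierDelta_of_varpi_mul_mem`). [cite: Hartshorne1977, III Prop. 9.7 p. 257] -/
theorem flat_carrierDelta_subschemeι_comp {P X₁ : Scheme.{0}} (q : P ⟶ Spec (.of O)) [IsSeparated q]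
    (s : Spec (.of O) ⟶ P) (hs : s ≫ q = 𝟙 _) (τ : X₁ ⟶ P) (hτ : IsBlowup τ s.ker) [IsLocallyNoetherian X₁]
    (K : P.IdealSheafData) {r : ℕ} (c : Fin r → P.presheaf.stalk (s (IsLocalRing.closedPoint O)))
    (hcJ : Ideal.span (Set.range c) = stalkIdeal s.ker (s (IsLocalRing.closedPoint O))) (hc : IsQuasiRegular c)
    [IsDomain (P.presheaf.stalk (s (IsLocalRing.closedPoint O)) ⧸ Ideal.span (Set.range c))] {d : ℕ}
    (Φ : MvPolynomial (Fin r) (P.presheaf.stalk (s (IsLocalRing.closedPoint O)))) (hΦd : Φ.IsHomogeneous d)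
    (hK : stalkIdeal K (s (IsLocalRing.closedPoint O)) = Ideal.span {MvPolynomial.eval c Φ})
    (ϖ : O) (hϖ : Irreducible ϖ)
    (h𝔪 : Ideal.span (Set.range c) ⊔ Ideal.span {(P.presheaf.Γgerm (s (IsLocalRing.closedPoint O))).hom
        (q.appTop.hom ((Scheme.ΓSpecIso (.of O)).inv.hom ϖ))} =
      maximalIdeal (P.presheaf.stalk (s (IsLocalRing.closedPoint O))))
    (hϖc : (P.presheaf.Γgerm (s (IsLocalRing.closedPoint O))).hom (q.appTop.hom ((Scheme.ΓSpecIso (.of O)).inv.hom ϖ)) ∉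
      Ideal.span (Set.range c))
    (hΦ𝔪 : MvPolynomial.map (IsLocalRing.residue (P.presheaf.stalk (s (IsLocalRing.closedPoint O)))) Φ ≠ 0) :
    Flat ((strictTransformIdeal τ s.ker K ⊔ s.ker.comap τ).subschemeι ≫ τ ≫ q) := by
  -- adapted from `ZariskiChow.flat_of_isIntegral_of_surjective` (Literature/AlgebraicGeometry/Motives/ZariskiChowCover.lean)
  apply HasRingHomProperty.of_iSup_eq_top (P := @Flat)
    (fun V : (strictTransformIdeal τ s.ker K ⊔ s.ker.comap τ).subscheme.affineOpens => V)
    (iSup_affineOpens_eq_top _)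
  intro V
  letI := (((strictTransformIdeal τ s.ker K ⊔ s.ker.comap τ).subschemeι ≫ τ ≫ q).appLE ⊤
    (V : (strictTransformIdeal τ s.ker K ⊔ s.ker.comap τ).subscheme.Opens) le_top).hom.toAlgebra
  change Module.Flat Γ(Spec (.of O), ⊤) Γ((strictTransformIdeal τ s.ker K ⊔ s.ker.comap τ).subscheme, V)
  -- `Γ(Spec O, ⊤) ≅ O` is a principal ideal domain
  let eR : O ≃+* Γ(Spec (.of O), ⊤) := (Scheme.ΓSpecIso (.of O)).symm.commRingCatIsoToRingEquiv
  haveI : IsDomain Γ(Spec (.of O), ⊤) := MulEquiv.isDomain O eR.symm.toMulEquiv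
  haveI : IsPrincipalIdealRing Γ(Spec (.of O), ⊤) :=
    IsPrincipalIdealRing.of_surjective eR.toRingHom eR.surjective
  rw [Module.Flat.flat_iff_torsion_eq_bot_of_isBezout, ← Submodule.isTorsionFree_iff_torsion_eq_bot]
  refine ⟨fun ρ hρ => ?_⟩
  rw [isSMulRegular_iff_right_eq_zero_of_smul]
  intro m hm
  rw [Algebra.smul_def] at hm
  change (((strictTransformIdeal τ s.ker K ⊔ s.ker.comap τ).subschemeι ≫ τ ≫ q).appLE ⊤ _ le_top).hom ρ * m = 0 at hm
  -- `ρ = u ϖⁿ`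
  have hρ0 : eR.symm ρ ≠ 0 := fun h => hρ.ne_zero (by simpa using congrArg eR h)
  obtain ⟨n, u, hu⟩ := IsDiscreteValuationRing.eq_unit_mul_pow_irreducible hρ0 hϖ
  have hρeq : ρ = eR (u : O) * eR ϖ ^ n := by
    rw [← map_pow, ← map_mul, ← hu, RingEquiv.apply_symm_apply]
  have heR : ∀ a : O, eR a = (Scheme.ΓSpecIso (.of O)).inv.hom a := fun a => rfl
  -- KEY: `ϖ` is a nonzerodivisor on `Γ(V(C), V)` — checked on the stalks
  have hw : ∀ m' : Γ((strictTransformIdeal τ s.ker K ⊔ s.ker.comap τ).subscheme, V),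
      (((strictTransformIdeal τ s.ker K ⊔ s.ker.comap τ).subschemeι ≫ τ ≫ q).appLE ⊤ _ le_top).hom (eR ϖ) * m' = 0 →
        m' = 0 := by
    intro m' hm'
    apply TopCat.Presheaf.section_ext (strictTransformIdeal τ s.ker K ⊔ s.ker.comap τ).subscheme.sheaf _ m' 0
    intro z hz
    rw [map_zero]
    have hgerm := congrArg ((strictTransformIdeal τ s.ker K ⊔ s.ker.comap τ).subscheme.presheaf.germ _ z hz).hom hm'
    rw [map_mul, map_zero, heR, germ_appLE_top, Scheme.Hom.stalkMap_comp, Scheme.Hom.stalkMap_comp] at hgerm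
    change ((strictTransformIdeal τ s.ker K ⊔ s.ker.comap τ).subschemeι.stalkMap z).hom
      ((τ.stalkMap _).hom ((q.stalkMap _).hom (((Spec (.of O)).presheaf.germ ⊤ _ trivial).hom
        ((Scheme.ΓSpecIso (.of O)).inv.hom ϖ)))) * _ = 0 at hgerm
    by_cases hy : q (τ ((strictTransformIdeal τ s.ker K ⊔ s.ker.comap τ).subschemeι z)) = IsLocalRing.closedPoint O
    · -- over the closed point: the point lies over `s(s₀)`, where `ϖ` is a nonzerodivisor modulo `C_{x'}`
      have hx'C : (strictTransformIdeal τ s.ker K ⊔ s.ker.comap τ).subschemeι z ∈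
          ((strictTransformIdeal τ s.ker K ⊔ s.ker.comap τ).support : Set X₁) := by
        rw [← Scheme.IdealSheafData.range_subschemeι]; exact Set.mem_range_self z
      obtain ⟨t, ht⟩ := image_support_carrierDelta_subset_range O q s hs τ K ⟨_, hx'C, rfl⟩
      have hcomp : ∀ t', q (s t') = t' := fun t' => by rw [← Scheme.Hom.comp_apply, hs]; rfl
      have htt : t = IsLocalRing.closedPoint O := by rw [← hcomp t, ht]; exact hy
      rw [htt] at ht
      -- `q^♯` of the germ of `ϖ` is the germ of `q^* ϖ`
      rw [Scheme.Hom.germ_stalkMap_apply] at hgerm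
      change ((strictTransformIdeal τ s.ker K ⊔ s.ker.comap τ).subschemeι.stalkMap z).hom
        ((τ.stalkMap _).hom ((P.presheaf.Γgerm _).hom (q.appTop.hom ((Scheme.ΓSpecIso (.of O)).inv.hom ϖ)))) * _ = 0
        at hgerm
      -- the germ of `m'` is `ι^♯ a`
      obtain ⟨a, ha⟩ := (strictTransformIdeal τ s.ker K ⊔ s.ker.comap τ).subschemeι.stalkMap_surjective z
        (((strictTransformIdeal τ s.ker K ⊔ s.ker.comap τ).subscheme.presheaf.germ _ z hz).hom m')
      have hker : RingHom.ker ((strictTransformIdeal τ s.ker K ⊔ s.ker.comap τ).subschemeι.stalkMap z).hom =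
          stalkIdeal (strictTransformIdeal τ s.ker K ⊔ s.ker.comap τ)
            ((strictTransformIdeal τ s.ker K ⊔ s.ker.comap τ).subschemeι z) := by
        rw [← stalkIdeal_ker_eq_ker_stalkMap, Scheme.IdealSheafData.ker_subschemeι]
      rw [← ha, ← map_mul, ← RingHom.mem_ker, hker] at hgerm
      have key := mem_stalkIdeal_carrierDelta_of_varpi_mul_mem hτ K _ (s (IsLocalRing.closedPoint O)) ht.symm
        (by rw [ht]; exact image_support_strictTransformIdeal_sup_comap_subset τ s.ker K ⟨_, hx'C, rfl⟩)
        c hcJ hc Φ hΦd hK (q.appTop.hom ((Scheme.ΓSpecIso (.of O)).inv.hom ϖ)) h𝔪 hϖc hΦ𝔪 a hgerm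
      change (((strictTransformIdeal τ s.ker K ⊔ s.ker.comap τ).subscheme.presheaf.germ _ z hz).hom m') = 0
      rw [← ha]
      rw [← hker, RingHom.mem_ker] at key
      exact key
    · -- over the generic point: `ϖ` is a unit there
      have hunit := ((isUnit_germ_of_ne_closedPoint O _ hy hϖ.ne_zero).map (q.stalkMap _).hom).map
        (τ.stalkMap _).hom |>.map ((strictTransformIdeal τ s.ker K ⊔ s.ker.comap τ).subschemeι.stalkMap z).hom
      change (((strictTransformIdeal τ s.ker K ⊔ s.ker.comap τ).subscheme.presheaf.germ _ z hz).hom m') = 0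
      exact (hunit.mul_right_eq_zero).mp hgerm
  -- conclude: `ρ • m = u ϖⁿ m = 0 ⇒ m = 0`
  rw [hρeq, map_mul, map_pow, mul_assoc] at hm
  have hm' := ((u.isUnit.map eR).map _).mul_right_eq_zero.mp hm
  clear hm hρeq hu
  induction n generalizing m with
  | zero => simpa using hm'
  | succ n ih =>
    rw [pow_succ, mul_assoc] at hm'
    exact hw m (ih _ hm')

end Flat

end Summit.ResolutionOfSingularities.ResolutionOfSingularities.Cruxes.EquisingularLiftNat.Sections

end
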